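import Summits.AtomisticToContinuum.Crystallization.Theses.FrustrationRangeCertificates
import Summits.AtomisticToContinuum.Crystallization.Theorems.FrustrationRangeCertificatesPatternPricedCertificatesStubLensLift
import Summits.AtomisticToContinuum.Crystallization.Theorems.FrustrationRangeCertificatesPatternPricedCertificatesStubFarField
import Summits.AtomisticToContinuum.Crystallization.Theorems.FrustrationRangeCertificatesPatternPricedCertificatesStubMeanDuality
import Summits.AtomisticToContinuum.Crystallization.Theorems.FrustrationRangeCertificatesPatternPricedCertificatesStubLevelLift
import Summits.AtomisticToContinuum.Crystallization.Theorems.FrustrationRangeCertificatesPatternPricedCertificatesStubPeriodicMeanFamily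
import Summits.AtomisticToContinuum.Crystallization.Theorems.FrustrationRangeCertificatesPatternPricedCertificatesStubPeriodicTransport
import Summits.AtomisticToContinuum.Crystallization.Theorems.FrustrationRangeCertificatesPatternPricedCertificatesStubPeriodicTruncatedEnergy
import Literature.MathematicalPhysics.StatisticalMechanics.TransferLevelValue
import Literature.Probability.PointProcesses.LensConsistentLaw

/-!
# Crux `PatternPricedCertificates` (stmt-AtomisticToContinuum-12974), line `registered` — the primal core and its consequences

This file makes the line's reduction IMPORTABLE. Its hypothesis is the single open stub of the line,
`stub_stationaryMeansRigidity` (priced rigidity of point-stationary MEAN families on rooted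
`δ`-separated configurations of `ℝ³`, written out below as a proposition; see
`Cruxes/PatternPricedCertificates/Lines/birth.lean` and `Lines/birth.md`). From it:

* `primalCore_dualCertificates` — the finite-level DUAL certificate of the birth line (pattern-pointwise
  priced certificate for the truncated one-centre energy with a bounded-range pattern-local transfer
  rule), by the landed level lift `stub_levelLift` (ultralimit of finite-level lens-consistent means,
  `stub_banachLimit`, `stub_levelRestrict`, `stub_patternFarField`) and the landed strong duality for
  means `stub_meanDuality` (Hahn–Banach, `stub_abstractMeanDuality`); budget split `θ/2, κθ/4, κθ/4`.
* `patternPricedCertificates_of_stationaryMeansRigidity` — **the crux by name**: the dual certificate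
  is lifted to the route's configuration-level certificate by the landed lens lift `stub_lensLift`
  (finite-volume mass transport) and the landed far field `stub_farField`, with the separation
  `δ` of Lennard-Jones ground states from `LennardJonesMinimalDistance_holds`. So the crux
  `PatternPricedCertificates` (and with it, by the route's proved hinges, Lennard-Jones
  crystallization onto `P`) follows from the primal core alone.
* `periodicDefectPrice_of_stationaryMeansRigidity` — **the formal kill criterion**: with the core's
  `P, κ, c, Q` (`e(Q) ≤ c + κθ`), every periodic configuration `Q'` of `ℝ³` with `δ`-separated point set
  has `c + κ · (fraction of motif sites of Q' whose (R, ε)-pattern is not an isometric copy of P's)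
  ≤ e(Q')` — periodic configurations rooted uniformly over the motif are point-stationary mean
  families (`stub_periodicMeanFamily`, `stub_periodicTransport`), the defect indicator is a cylinder
  functional (`levelLift_good_ballPattern_iff`), truncated energies tend to `e(Q')`
  (`stub_periodicTruncatedEnergy`). A `δ`-separated all-bad periodic family with `e(Q'_n) → inf e`
  refutes the core.

No new definitions (the core is a hypothesis, stated inline); nothing else is assumed. [folklore]
-/

noncomputable section

open scoped BigOperators Topology Classical

namespace Summit.AtomisticToContinuum.Crystallization.Theorems.PatternPricedCertificates

open Literature.Probability.PointProcesses (IsRootedPattern ballPattern lens reroot)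
open Literature.MathematicalPhysics.StatisticalMechanics (lennardJones relPattern)

section Helpers

variable {N : ℕ}

/-- The truncated one-centre sum over the `L`-pattern is the truncated site sum: `Σ_{v ∈ P_L i} f ‖v‖ =
Σ_{j ≠ i, |x_i − x_j| ≤ L} f |x_i − x_j|` for an injective configuration. [folklore] -/
theorem primalCore_sum_relPattern_eq (f : ℝ → ℝ) (L : ℝ) {x : Fin N → EuclideanSpace ℝ (Fin 3)}
    (hx : Function.Injective x) (i : Fin N) :
    ∑ v ∈ Literature.MathematicalPhysics.StatisticalMechanics.relPattern L x i, f ‖v‖ =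
      ∑ j ∈ (Finset.univ.erase i).filter (fun j => dist (x i) (x j) ≤ L), f (dist (x i) (x j)) := by
  unfold Literature.MathematicalPhysics.StatisticalMechanics.relPattern
  rw [Finset.sum_image]
  · have hs : (Finset.univ.filter fun k : Fin N => k ≠ i ∧ dist (x i) (x k) ≤ L) =
        (Finset.univ.erase i).filter (fun j => dist (x i) (x j) ≤ L) := by
      ext k
      simp only [Finset.mem_filter, Finset.mem_univ, true_and, Finset.mem_erase, and_true]
    rw [hs]
    refine Finset.sum_congr rfl fun k _ => ?_
    rw [← dist_eq_norm, dist_comm]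
  · intro k _ l _ hkl
    exact hx (sub_left_injective hkl)

/-- **Pattern form of the defect predicate.** For `0 ≤ R`, `0 ≤ ε`, `R + ε ≤ L`, the crux's particle-form
`(R, ε)`-matching predicate at particle `i` (test particles `j : Fin N`) coincides with the pattern form on
the rooted `L`-pattern of `i` with the root adjoined (`insert 0 (relPattern L x i)`): a particle matched to
`x_i + A p`, `‖p‖ ≤ R`, lies within `R + ε ≤ L` of `x_i` (`‖A p‖ = ‖p‖`). [folklore] -/
theorem primalCore_good_iff (P : Literature.MathematicalPhysics.StatisticalMechanics.PeriodicConfiguration 3)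
    {R ε L : ℝ} (hR : 0 ≤ R) (hε : 0 ≤ ε) (hRL : R + ε ≤ L)
    (x : Fin N → EuclideanSpace ℝ (Fin 3)) (i : Fin N) :
    (∃ A : EuclideanSpace ℝ (Fin 3) →ₗᵢ[ℝ] EuclideanSpace ℝ (Fin 3),
        (∀ p ∈ P.points, ‖p‖ ≤ R → ∃ j : Fin N, dist (x j) (x i + A p) ≤ ε) ∧
        (∀ j : Fin N, dist (x j) (x i) ≤ R → ∃ p ∈ P.points, dist (x j) (x i + A p) ≤ ε)) ↔
    (∃ A : EuclideanSpace ℝ (Fin 3) →ₗᵢ[ℝ] EuclideanSpace ℝ (Fin 3),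
        (∀ p ∈ P.points, ‖p‖ ≤ R →
          ∃ v ∈ insert (0 : EuclideanSpace ℝ (Fin 3))
            (Literature.MathematicalPhysics.StatisticalMechanics.relPattern L x i), dist v (A p) ≤ ε) ∧
        (∀ v ∈ insert (0 : EuclideanSpace ℝ (Fin 3))
            (Literature.MathematicalPhysics.StatisticalMechanics.relPattern L x i),
          ‖v‖ ≤ R → ∃ p ∈ P.points, dist v (A p) ≤ ε)) := by
  have hL0 : 0 ≤ L := by linarith
  -- membership in the rooted pattern with the root adjoined
  have hmem : ∀ j : Fin N, dist (x i) (x j) ≤ L →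
      x j - x i ∈ insert (0 : EuclideanSpace ℝ (Fin 3))
        (Literature.MathematicalPhysics.StatisticalMechanics.relPattern L x i) := by
    intro j hj
    by_cases hji : j = i
    · subst hji
      simp
    · refine Finset.mem_insert_of_mem (Finset.mem_image.2 ⟨j, ?_, rfl⟩)
      simp [hji, hj]
  have hmem' : ∀ v ∈ insert (0 : EuclideanSpace ℝ (Fin 3))
      (Literature.MathematicalPhysics.StatisticalMechanics.relPattern L x i),
      ∃ j : Fin N, dist (x i) (x j) ≤ L ∧ v = x j - x i := by
    intro v hv
    rcases Finset.mem_insert.1 hv with rfl | hv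
    · exact ⟨i, by rw [dist_self]; exact hL0, (sub_self _).symm⟩
    · obtain ⟨k, hk, rfl⟩ := Finset.mem_image.1 hv
      simp only [Finset.mem_filter, Finset.mem_univ, true_and] at hk
      exact ⟨k, hk.2, rfl⟩
  -- the displacement identity
  have hdist : ∀ (j : Fin N) (A : EuclideanSpace ℝ (Fin 3) →ₗᵢ[ℝ] EuclideanSpace ℝ (Fin 3))
      (p : EuclideanSpace ℝ (Fin 3)), dist (x j) (x i + A p) = dist (x j - x i) (A p) := by
    intro j A p
    rw [dist_eq_norm, dist_eq_norm, sub_add_eq_sub_sub]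
  have hAp : ∀ (A : EuclideanSpace ℝ (Fin 3) →ₗᵢ[ℝ] EuclideanSpace ℝ (Fin 3))
      (p : EuclideanSpace ℝ (Fin 3)), dist (x i + A p) (x i) = ‖p‖ := by
    intro A p
    rw [dist_eq_norm, add_sub_cancel_left, A.norm_map]
  constructor
  · rintro ⟨A, h1, h2⟩
    refine ⟨A, fun p hp hpR => ?_, fun v hv hvR => ?_⟩
    · obtain ⟨j, hj⟩ := h1 p hp hpR
      refine ⟨x j - x i, hmem j ?_, by rwa [← hdist]⟩
      calc dist (x i) (x j) = dist (x j) (x i) := dist_comm _ _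
        _ ≤ dist (x j) (x i + A p) + dist (x i + A p) (x i) := dist_triangle _ _ _
        _ ≤ ε + ‖p‖ := by rw [hAp]; linarith
        _ ≤ L := by linarith
    · obtain ⟨j, hjL, rfl⟩ := hmem' v hv
      have hjR : dist (x j) (x i) ≤ R := by rwa [dist_eq_norm]
      obtain ⟨p, hp, hjp⟩ := h2 j hjR
      exact ⟨p, hp, by rwa [← hdist]⟩
  · rintro ⟨A, h1, h2⟩
    refine ⟨A, fun p hp hpR => ?_, fun j hjR => ?_⟩
    · obtain ⟨v, hv, hvp⟩ := h1 p hp hpR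
      obtain ⟨j, -, rfl⟩ := hmem' v hv
      exact ⟨j, by rwa [hdist]⟩
    · have hjL : dist (x i) (x j) ≤ L := by rw [dist_comm]; linarith
      have hvR : ‖x j - x i‖ ≤ R := by rwa [← dist_eq_norm]
      obtain ⟨p, hp, hvp⟩ := h2 (x j - x i) (hmem j hjL) hvR
      exact ⟨p, hp, by rwa [hdist]⟩

end Helpers

/-- **The dual finite-level certificate from the primal core** (the birth line's stub
`stub_patternCertificates`, derived): take `P, κ, c, Q` from the core at budget `θ/2`; the level lift
(`stub_levelLift`, `η = κθ/4`) gives a level `(r, L)` beyond `L₀` at which every lens-consistent mean is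
non-negative on `a := ½h_L − κ·bad − (c − κθ/4)` (bounded by `levelLift_abs_sum_le`); strong duality for
means (`stub_meanDuality`, `η = κθ/4`) gives a bounded rule `g` with `(c − κθ/2) + κ·bad ≤ ½h_L + T_g`
pointwise on admissible patterns, and `e(Q) ≤ (c − κθ/2) + κθ`. [folklore] -/
theorem primalCore_dualCertificates
    (hA :
    ∃ P : Literature.MathematicalPhysics.StatisticalMechanics.PeriodicConfiguration 3, ∀ δ R ε θ : ℝ, 0 < δ → 0 < R → 0 < ε → 0 < θ →
      ∃ (κ c : ℝ) (Q : Literature.MathematicalPhysics.StatisticalMechanics.PeriodicConfiguration 3), 0 < κ ∧ κ ≤ 1 ∧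
        Q.energyPerParticle Literature.MathematicalPhysics.StatisticalMechanics.lennardJones ≤ c + κ * θ ∧
        ∀ ℓ : ℝ → (Finset (EuclideanSpace ℝ (Fin 3)) → ℝ) → ℝ,
          (∀ (ρ : ℝ) (f₁ f₂ : Finset (EuclideanSpace ℝ (Fin 3)) → ℝ), ℓ ρ (f₁ + f₂) = ℓ ρ f₁ + ℓ ρ f₂) →
          (∀ (ρ t : ℝ) (f : Finset (EuclideanSpace ℝ (Fin 3)) → ℝ), ℓ ρ (t • f) = t * ℓ ρ f) →
          (∀ (ρ : ℝ) (f : Finset (EuclideanSpace ℝ (Fin 3)) → ℝ), (∀ S : Finset (EuclideanSpace ℝ (Fin 3)), Literature.Probability.PointProcesses.IsRootedPattern δ ρ S → 0 ≤ f S ∧ f S ≤ 1) → 0 ≤ ℓ ρ f) →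
          (∀ ρ : ℝ, ℓ ρ (fun _ => 1) = 1) →
          (∀ ρ ρ' : ℝ, ρ ≤ ρ' → ∀ f : Finset (EuclideanSpace ℝ (Fin 3)) → ℝ, ℓ ρ' (fun S => f (Literature.Probability.PointProcesses.ballPattern ρ S)) = ℓ ρ f) →
          (∀ r ρ : ℝ, 0 ≤ r → ∀ g : EuclideanSpace ℝ (Fin 3) → Finset (EuclideanSpace ℝ (Fin 3)) → Finset (EuclideanSpace ℝ (Fin 3)) → ℝ, (∃ M : ℝ, ∀ v p q, |g v p q| ≤ M) →
            ℓ ρ (fun S => ∑ v ∈ Literature.Probability.PointProcesses.lens r ρ S, (g v (Literature.Probability.PointProcesses.ballPattern r S) (Literature.Probability.PointProcesses.ballPattern r (Literature.Probability.PointProcesses.reroot S v)) - g (-v) (Literature.Probability.PointProcesses.ballPattern r (Literature.Probability.PointProcesses.reroot S v)) (Literature.Probability.PointProcesses.ballPattern r S))) = 0) →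
          ∀ ρ : ℝ, R + ε ≤ ρ → 1 ≤ ρ →
            c + κ * ℓ ρ (fun S => (if (∃ A : EuclideanSpace ℝ (Fin 3) →ₗᵢ[ℝ] EuclideanSpace ℝ (Fin 3), (∀ p ∈ P.points, ‖p‖ ≤ R → ∃ v ∈ insert (0 : EuclideanSpace ℝ (Fin 3)) S, dist v (A p) ≤ ε) ∧ (∀ v ∈ insert (0 : EuclideanSpace ℝ (Fin 3)) S, ‖v‖ ≤ R → ∃ p ∈ P.points, dist v (A p) ≤ ε)) then (0 : ℝ) else 1)) ≤
              ℓ ρ (fun S => (∑ v ∈ S, Literature.MathematicalPhysics.StatisticalMechanics.lennardJones ‖v‖) / 2)) :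
  ∃ P : Literature.MathematicalPhysics.StatisticalMechanics.PeriodicConfiguration 3, ∀ δ R ε θ : ℝ, 0 < δ → 0 < R → 0 < ε → 0 < θ →
      ∃ κ : ℝ, 0 < κ ∧ κ ≤ 1 ∧ ∀ L₀ : ℝ,
        ∃ (L r c : ℝ) (g : EuclideanSpace ℝ (Fin 3) → Finset (EuclideanSpace ℝ (Fin 3)) → Finset (EuclideanSpace ℝ (Fin 3)) → ℝ)
          (Q : Literature.MathematicalPhysics.StatisticalMechanics.PeriodicConfiguration 3),
          L₀ ≤ L ∧ R + ε ≤ L ∧ 0 ≤ r ∧ r ≤ L ∧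
          Q.energyPerParticle Literature.MathematicalPhysics.StatisticalMechanics.lennardJones ≤ c + κ * θ ∧
          ∀ S : Finset (EuclideanSpace ℝ (Fin 3)), Literature.Probability.PointProcesses.IsRootedPattern δ L S →
            c + (if (∃ A : EuclideanSpace ℝ (Fin 3) →ₗᵢ[ℝ] EuclideanSpace ℝ (Fin 3),
                    (∀ p ∈ P.points, ‖p‖ ≤ R → ∃ v ∈ insert (0 : EuclideanSpace ℝ (Fin 3)) S, dist v (A p) ≤ ε) ∧
                    (∀ v ∈ insert (0 : EuclideanSpace ℝ (Fin 3)) S, ‖v‖ ≤ R → ∃ p ∈ P.points, dist v (A p) ≤ ε))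
                  then 0 else κ)
              ≤ (∑ v ∈ S, Literature.MathematicalPhysics.StatisticalMechanics.lennardJones ‖v‖) / 2 +
                ∑ v ∈ Literature.Probability.PointProcesses.lens r L S,
                  (g v (Literature.Probability.PointProcesses.ballPattern r S) (Literature.Probability.PointProcesses.ballPattern r (Literature.Probability.PointProcesses.reroot S v)) -
                    g (-v) (Literature.Probability.PointProcesses.ballPattern r (Literature.Probability.PointProcesses.reroot S v)) (Literature.Probability.PointProcesses.ballPattern r S)) := by
  obtain ⟨P, hP⟩ := hA
  refine ⟨P, fun δ R ε θ hδ hR hε hθ => ?_⟩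
  obtain ⟨κ, c, Q, hκ0, hκ1, hQ, hprim⟩ := hP δ R ε (θ / 2) hδ hR hε (half_pos hθ)
  refine ⟨κ, hκ0, hκ1, fun L₀ => ?_⟩
  have hη : 0 < κ * θ / 4 := by positivity
  obtain ⟨L, r, hL₀L, hRL, hr0, hrL, hfin⟩ := stub_levelLift P δ R ε κ c hδ hR hε hprim (κ * θ / 4) hη L₀
  set bad : Finset (EuclideanSpace ℝ (Fin 3)) → ℝ := fun S => (if (∃ A : EuclideanSpace ℝ (Fin 3) →ₗᵢ[ℝ] EuclideanSpace ℝ (Fin 3), (∀ p ∈ P.points, ‖p‖ ≤ R → ∃ v ∈ insert (0 : EuclideanSpace ℝ (Fin 3)) S, dist v (A p) ≤ ε) ∧ (∀ v ∈ insert (0 : EuclideanSpace ℝ (Fin 3)) S, ‖v‖ ≤ R → ∃ p ∈ P.points, dist v (A p) ≤ ε)) then (0 : ℝ) else 1) with hbad_def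
  set half : Finset (EuclideanSpace ℝ (Fin 3)) → ℝ := fun S => (∑ v ∈ S, Literature.MathematicalPhysics.StatisticalMechanics.lennardJones ‖v‖) / 2 with hhalf_def
  set a : Finset (EuclideanSpace ℝ (Fin 3)) → ℝ := fun S => half S - κ * bad S - (c - κ * θ / 4) with ha_def
  obtain ⟨M, hM⟩ := levelLift_abs_sum_le hδ L
  have hbad1 : ∀ S, |bad S| ≤ 1 := fun S => by
    simp only [hbad_def]
    split_ifs <;> simp
  have ha_bdd : ∃ M' : ℝ, ∀ S : Finset (EuclideanSpace ℝ (Fin 3)), IsRootedPattern δ L S → |a S| ≤ M' := by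
    refine ⟨M / 2 + |κ| + |c - κ * θ / 4|, fun S hS => ?_⟩
    have h1 : |half S| ≤ M / 2 := by
      have : |half S| = |∑ v ∈ S, lennardJones ‖v‖| / 2 := by
        simp only [hhalf_def, abs_div, abs_two]
      rw [this]
      linarith [hM S hS]
    have h2 : |κ * bad S| ≤ |κ| := by
      rw [abs_mul]
      exact mul_le_of_le_one_right (abs_nonneg κ) (hbad1 S)
    calc |a S| = |half S - κ * bad S - (c - κ * θ / 4)| := rfl
      _ ≤ |half S - κ * bad S| + |c - κ * θ / 4| := abs_sub _ _
      _ ≤ |half S| + |κ * bad S| + |c - κ * θ / 4| := by gcongr; exact abs_sub _ _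
      _ ≤ M / 2 + |κ| + |c - κ * θ / 4| := by gcongr
  have hyp : ∀ m : (Finset (EuclideanSpace ℝ (Fin 3)) → ℝ) → ℝ,
      (∀ f₁ f₂ : Finset (EuclideanSpace ℝ (Fin 3)) → ℝ, m (f₁ + f₂) = m f₁ + m f₂) →
      (∀ (t : ℝ) (f : Finset (EuclideanSpace ℝ (Fin 3)) → ℝ), m (t • f) = t * m f) →
      (∀ f : Finset (EuclideanSpace ℝ (Fin 3)) → ℝ, (∀ S : Finset (EuclideanSpace ℝ (Fin 3)), IsRootedPattern δ L S → 0 ≤ f S ∧ f S ≤ 1) → 0 ≤ m f) →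
      m (fun _ => 1) = 1 →
      (∀ g : EuclideanSpace ℝ (Fin 3) → Finset (EuclideanSpace ℝ (Fin 3)) → Finset (EuclideanSpace ℝ (Fin 3)) → ℝ, (∃ M : ℝ, ∀ v p q, |g v p q| ≤ M) →
        m (fun S => ∑ v ∈ Literature.Probability.PointProcesses.lens r L S, (g v (Literature.Probability.PointProcesses.ballPattern r S) (Literature.Probability.PointProcesses.ballPattern r (Literature.Probability.PointProcesses.reroot S v)) - g (-v) (Literature.Probability.PointProcesses.ballPattern r (Literature.Probability.PointProcesses.reroot S v)) (Literature.Probability.PointProcesses.ballPattern r S))) = 0) →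
      0 ≤ m a := by
    intro m hadd hsmul hpos hone hcons
    have h := hfin m hadd hsmul hpos hone hcons
    have ha : a = half + ((-κ) • bad + (fun _ => -(c - κ * θ / 4))) := by
      ext S
      simp only [ha_def, Pi.add_apply, Pi.smul_apply, smul_eq_mul]
      ring
    rw [ha, hadd, hadd, hsmul, levelLift_mean_const hsmul hone]
    linarith
  obtain ⟨g, hg, hcert⟩ := stub_meanDuality δ r L hδ a ha_bdd hyp (κ * θ / 4) hη
  refine ⟨L, r, c - κ * θ / 2, g, Q, hL₀L, hRL, hr0, hrL, by linarith, fun S hS => ?_⟩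
  have h := hcert S hS
  simp only [ha_def, hhalf_def, hbad_def] at h
  split_ifs at h with hgood
  · rw [if_pos hgood]
    linarith
  · rw [if_neg hgood]
    linarith

/-- **The crux from the primal core.** `PatternPricedCertificates` (route FrustrationRangeCertificates,
stmt-AtomisticToContinuum-12974) follows from the priced rigidity of point-stationary mean families:
the dual certificate `primalCore_dualCertificates` is lifted to the route's configuration-level
certificate by the lens lift (`stub_lensLift`) and the far field (`stub_farField`), `δ` from
`LennardJonesMinimalDistance_holds`; budget `θ/2` for the dual certificate, `κθ`-far field absorbed by
`c ↦ c − κθ/2`. [folklore] -/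
theorem patternPricedCertificates_of_stationaryMeansRigidity :
    (
    ∃ P : Literature.MathematicalPhysics.StatisticalMechanics.PeriodicConfiguration 3, ∀ δ R ε θ : ℝ, 0 < δ → 0 < R → 0 < ε → 0 < θ →
      ∃ (κ c : ℝ) (Q : Literature.MathematicalPhysics.StatisticalMechanics.PeriodicConfiguration 3), 0 < κ ∧ κ ≤ 1 ∧
        Q.energyPerParticle Literature.MathematicalPhysics.StatisticalMechanics.lennardJones ≤ c + κ * θ ∧
        ∀ ℓ : ℝ → (Finset (EuclideanSpace ℝ (Fin 3)) → ℝ) → ℝ,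
          (∀ (ρ : ℝ) (f₁ f₂ : Finset (EuclideanSpace ℝ (Fin 3)) → ℝ), ℓ ρ (f₁ + f₂) = ℓ ρ f₁ + ℓ ρ f₂) →
          (∀ (ρ t : ℝ) (f : Finset (EuclideanSpace ℝ (Fin 3)) → ℝ), ℓ ρ (t • f) = t * ℓ ρ f) →
          (∀ (ρ : ℝ) (f : Finset (EuclideanSpace ℝ (Fin 3)) → ℝ), (∀ S : Finset (EuclideanSpace ℝ (Fin 3)), Literature.Probability.PointProcesses.IsRootedPattern δ ρ S → 0 ≤ f S ∧ f S ≤ 1) → 0 ≤ ℓ ρ f) →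
          (∀ ρ : ℝ, ℓ ρ (fun _ => 1) = 1) →
          (∀ ρ ρ' : ℝ, ρ ≤ ρ' → ∀ f : Finset (EuclideanSpace ℝ (Fin 3)) → ℝ, ℓ ρ' (fun S => f (Literature.Probability.PointProcesses.ballPattern ρ S)) = ℓ ρ f) →
          (∀ r ρ : ℝ, 0 ≤ r → ∀ g : EuclideanSpace ℝ (Fin 3) → Finset (EuclideanSpace ℝ (Fin 3)) → Finset (EuclideanSpace ℝ (Fin 3)) → ℝ, (∃ M : ℝ, ∀ v p q, |g v p q| ≤ M) →
            ℓ ρ (fun S => ∑ v ∈ Literature.Probability.PointProcesses.lens r ρ S, (g v (Literature.Probability.PointProcesses.ballPattern r S) (Literature.Probability.PointProcesses.ballPattern r (Literature.Probability.PointProcesses.reroot S v)) - g (-v) (Literature.Probability.PointProcesses.ballPattern r (Literature.Probability.PointProcesses.reroot S v)) (Literature.Probability.PointProcesses.ballPattern r S))) = 0) →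
          ∀ ρ : ℝ, R + ε ≤ ρ → 1 ≤ ρ →
            c + κ * ℓ ρ (fun S => (if (∃ A : EuclideanSpace ℝ (Fin 3) →ₗᵢ[ℝ] EuclideanSpace ℝ (Fin 3), (∀ p ∈ P.points, ‖p‖ ≤ R → ∃ v ∈ insert (0 : EuclideanSpace ℝ (Fin 3)) S, dist v (A p) ≤ ε) ∧ (∀ v ∈ insert (0 : EuclideanSpace ℝ (Fin 3)) S, ‖v‖ ≤ R → ∃ p ∈ P.points, dist v (A p) ≤ ε)) then (0 : ℝ) else 1)) ≤
              ℓ ρ (fun S => (∑ v ∈ S, Literature.MathematicalPhysics.StatisticalMechanics.lennardJones ‖v‖) / 2)) →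
    Summit.AtomisticToContinuum.Crystallization.Theses.FrustrationRangeCertificates.PatternPricedCertificates := by
  intro hA
  have h₁ := primalCore_dualCertificates hA
  -- stubs 2 and 3 are landed Theorems (no longer hypotheses of the skeleton)
  have h₂ := stub_lensLift
  have h₃ := stub_farField
  obtain ⟨P, hP⟩ := h₁
  obtain ⟨δ, hδ, hGS⟩ := Literature.MathematicalPhysics.StatisticalMechanics.LennardJonesMinimalDistance_holds
  unfold Summit.AtomisticToContinuum.Crystallization.Theses.FrustrationRangeCertificates.PatternPricedCertificates
  refine ⟨P, fun R ε θ hR hε hθ => ?_⟩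
  obtain ⟨κ, hκ0, hκ1, hκ⟩ := hP δ R ε (θ / 2) hδ hR hε (half_pos hθ)
  obtain ⟨L₀, hL₀⟩ := h₃ δ hδ (κ * θ) (mul_pos hκ0 hθ)
  obtain ⟨L, r, c, g, Q, hL₀L, hRL, hr0, hrL, hQ, hcert⟩ := hκ L₀
  refine ⟨δ, L, c - κ * θ / 2, κ,
    fun v p q => if ‖v‖ ≤ L - r then g v (Literature.Probability.PointProcesses.ballPattern r p) (Literature.Probability.PointProcesses.ballPattern r q) else 0,
    Q, hδ, hκ0, hκ1, hGS, by linarith, ?_⟩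
  intro N x hx pat i
  have hinj : Function.Injective x := lensLift_injective_of_separated hδ hx
  -- stub 2 applied to `F S := c + κ·1[bad S] − ½ Σ_{v ∈ S} V ‖v‖`
  have hF := h₂ δ r L hδ hr0 hrL
    (fun S => c + (if (∃ A : EuclideanSpace ℝ (Fin 3) →ₗᵢ[ℝ] EuclideanSpace ℝ (Fin 3),
        (∀ p ∈ P.points, ‖p‖ ≤ R → ∃ v ∈ insert (0 : EuclideanSpace ℝ (Fin 3)) S, dist v (A p) ≤ ε) ∧
        (∀ v ∈ insert (0 : EuclideanSpace ℝ (Fin 3)) S, ‖v‖ ≤ R → ∃ p ∈ P.points, dist v (A p) ≤ ε)) then (0 : ℝ) else κ) -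
      (∑ v ∈ S, Literature.MathematicalPhysics.StatisticalMechanics.lennardJones ‖v‖) / 2)
    g (fun S hS => by have h := hcert S hS; linarith) N x hx i
  beta_reduce at hF
  -- the truncated one-centre sum is the truncated site energy
  rw [primalCore_sum_relPattern_eq Literature.MathematicalPhysics.StatisticalMechanics.lennardJones L hinj i] at hF
  -- near/far split of the full site energy and the far-field bound (stub 3)
  have hsplit := Finset.sum_filter_add_sum_filter_not (Finset.univ.erase i)
    (fun j => dist (x i) (x j) ≤ L) (fun j => Literature.MathematicalPhysics.StatisticalMechanics.lennardJones (dist (x i) (x j)))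
  beta_reduce at hsplit
  have hfar := hL₀ L hL₀L N x hx i
  -- the defect predicate: particle form (crux) ↔ pattern form (stub 1)
  have hgood := primalCore_good_iff P hR.le hε.le hRL x i
  -- conclude, up to unfolding `pat i = relPattern L x i` and β-reducing the lifted rule (both `rfl`)
  suffices key : c - κ * θ / 2 + (if (∃ A : EuclideanSpace ℝ (Fin 3) →ₗᵢ[ℝ] EuclideanSpace ℝ (Fin 3),
        (∀ p ∈ P.points, ‖p‖ ≤ R → ∃ j : Fin N, dist (x j) (x i + A p) ≤ ε) ∧
        (∀ j : Fin N, dist (x j) (x i) ≤ R → ∃ p ∈ P.points, dist (x j) (x i + A p) ≤ ε)) then (0 : ℝ) else κ) ≤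
      (∑ j ∈ Finset.univ.erase i, Literature.MathematicalPhysics.StatisticalMechanics.lennardJones (dist (x i) (x j))) / 2 +
        ∑ j ∈ Finset.univ.erase i,
          ((if ‖x j - x i‖ ≤ L - r then
              g (x j - x i) (Literature.Probability.PointProcesses.ballPattern r (Literature.MathematicalPhysics.StatisticalMechanics.relPattern L x i))
                (Literature.Probability.PointProcesses.ballPattern r (Literature.MathematicalPhysics.StatisticalMechanics.relPattern L x j)) else 0) -
           (if ‖x i - x j‖ ≤ L - r then
              g (x i - x j) (Literature.Probability.PointProcesses.ballPattern r (Literature.MathematicalPhysics.StatisticalMechanics.relPattern L x j))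
                (Literature.Probability.PointProcesses.ballPattern r (Literature.MathematicalPhysics.StatisticalMechanics.relPattern L x i)) else 0)) by
    exact key
  by_cases hg : ∃ A : EuclideanSpace ℝ (Fin 3) →ₗᵢ[ℝ] EuclideanSpace ℝ (Fin 3),
      (∀ p ∈ P.points, ‖p‖ ≤ R → ∃ j : Fin N, dist (x j) (x i + A p) ≤ ε) ∧
      (∀ j : Fin N, dist (x j) (x i) ≤ R → ∃ p ∈ P.points, dist (x j) (x i + A p) ≤ ε)
  · rw [if_pos hg]
    rw [if_pos (hgood.1 hg)] at hF
    linarith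
  · rw [if_neg hg]
    rw [if_neg (fun h => hg (hgood.2 h))] at hF
    linarith


/-- **The formal kill criterion of the core (periodic defect price for separated periodic competitors).**
With the core's `P, κ, c, Q` (`e(Q) ≤ c + κθ`), every periodic `Q'` of `ℝ³` with `δ`-separated point set
satisfies `c + κ · (#motif)⁻¹ Σ_{x ∈ motif} bad_{P,R,ε}(pattern of Q' at x within R + ε) ≤ e(Q')`.
[folklore] -/
theorem periodicDefectPrice_of_stationaryMeansRigidity :
    (
    ∃ P : Literature.MathematicalPhysics.StatisticalMechanics.PeriodicConfiguration 3, ∀ δ R ε θ : ℝ, 0 < δ → 0 < R → 0 < ε → 0 < θ →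
      ∃ (κ c : ℝ) (Q : Literature.MathematicalPhysics.StatisticalMechanics.PeriodicConfiguration 3), 0 < κ ∧ κ ≤ 1 ∧
        Q.energyPerParticle Literature.MathematicalPhysics.StatisticalMechanics.lennardJones ≤ c + κ * θ ∧
        ∀ ℓ : ℝ → (Finset (EuclideanSpace ℝ (Fin 3)) → ℝ) → ℝ,
          (∀ (ρ : ℝ) (f₁ f₂ : Finset (EuclideanSpace ℝ (Fin 3)) → ℝ), ℓ ρ (f₁ + f₂) = ℓ ρ f₁ + ℓ ρ f₂) →
          (∀ (ρ t : ℝ) (f : Finset (EuclideanSpace ℝ (Fin 3)) → ℝ), ℓ ρ (t • f) = t * ℓ ρ f) →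
          (∀ (ρ : ℝ) (f : Finset (EuclideanSpace ℝ (Fin 3)) → ℝ), (∀ S : Finset (EuclideanSpace ℝ (Fin 3)), Literature.Probability.PointProcesses.IsRootedPattern δ ρ S → 0 ≤ f S ∧ f S ≤ 1) → 0 ≤ ℓ ρ f) →
          (∀ ρ : ℝ, ℓ ρ (fun _ => 1) = 1) →
          (∀ ρ ρ' : ℝ, ρ ≤ ρ' → ∀ f : Finset (EuclideanSpace ℝ (Fin 3)) → ℝ, ℓ ρ' (fun S => f (Literature.Probability.PointProcesses.ballPattern ρ S)) = ℓ ρ f) →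
          (∀ r ρ : ℝ, 0 ≤ r → ∀ g : EuclideanSpace ℝ (Fin 3) → Finset (EuclideanSpace ℝ (Fin 3)) → Finset (EuclideanSpace ℝ (Fin 3)) → ℝ, (∃ M : ℝ, ∀ v p q, |g v p q| ≤ M) →
            ℓ ρ (fun S => ∑ v ∈ Literature.Probability.PointProcesses.lens r ρ S, (g v (Literature.Probability.PointProcesses.ballPattern r S) (Literature.Probability.PointProcesses.ballPattern r (Literature.Probability.PointProcesses.reroot S v)) - g (-v) (Literature.Probability.PointProcesses.ballPattern r (Literature.Probability.PointProcesses.reroot S v)) (Literature.Probability.PointProcesses.ballPattern r S))) = 0) →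
          ∀ ρ : ℝ, R + ε ≤ ρ → 1 ≤ ρ →
            c + κ * ℓ ρ (fun S => (if (∃ A : EuclideanSpace ℝ (Fin 3) →ₗᵢ[ℝ] EuclideanSpace ℝ (Fin 3), (∀ p ∈ P.points, ‖p‖ ≤ R → ∃ v ∈ insert (0 : EuclideanSpace ℝ (Fin 3)) S, dist v (A p) ≤ ε) ∧ (∀ v ∈ insert (0 : EuclideanSpace ℝ (Fin 3)) S, ‖v‖ ≤ R → ∃ p ∈ P.points, dist v (A p) ≤ ε)) then (0 : ℝ) else 1)) ≤
              ℓ ρ (fun S => (∑ v ∈ S, Literature.MathematicalPhysics.StatisticalMechanics.lennardJones ‖v‖) / 2)) →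
    ∃ P : Literature.MathematicalPhysics.StatisticalMechanics.PeriodicConfiguration 3, ∀ δ R ε θ : ℝ, 0 < δ → 0 < R → 0 < ε → 0 < θ →
      ∃ (κ c : ℝ) (Q : Literature.MathematicalPhysics.StatisticalMechanics.PeriodicConfiguration 3), 0 < κ ∧ κ ≤ 1 ∧
        Q.energyPerParticle Literature.MathematicalPhysics.StatisticalMechanics.lennardJones ≤ c + κ * θ ∧
        ∀ Q' : Literature.MathematicalPhysics.StatisticalMechanics.PeriodicConfiguration 3, (∀ x ∈ Q'.points, ∀ y ∈ Q'.points, x ≠ y → δ ≤ dist x y) →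
          c + κ * ((Q'.motif.card : ℝ)⁻¹ * ∑ x ∈ Q'.motif, (if (∃ A : EuclideanSpace ℝ (Fin 3) →ₗᵢ[ℝ] EuclideanSpace ℝ (Fin 3), (∀ p ∈ P.points, ‖p‖ ≤ R → ∃ v ∈ insert (0 : EuclideanSpace ℝ (Fin 3)) (((Literature.MathematicalPhysics.StatisticalMechanics.PeriodicConfiguration.finite_inter_points Q' (Metric.isBounded_closedBall (x := x) (r := (R + ε)))).toFinset.erase x).image (fun y => y - x)), dist v (A p) ≤ ε) ∧ (∀ v ∈ insert (0 : EuclideanSpace ℝ (Fin 3)) (((Literature.MathematicalPhysics.StatisticalMechanics.PeriodicConfiguration.finite_inter_points Q' (Metric.isBounded_closedBall (x := x) (r := (R + ε)))).toFinset.erase x).image (fun y => y - x)), ‖v‖ ≤ R → ∃ p ∈ P.points, dist v (A p) ≤ ε)) then (0 : ℝ) else 1)) ≤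
            Q'.energyPerParticle Literature.MathematicalPhysics.StatisticalMechanics.lennardJones := by
  intro hA
  obtain ⟨P, hP⟩ := hA
  refine ⟨P, fun δ R ε θ hδ hR hε hθ => ?_⟩
  obtain ⟨κ, c, Q, hκ0, hκ1, hQ, hprim⟩ := hP δ R ε θ hδ hR hε hθ
  refine ⟨κ, c, Q, hκ0, hκ1, hQ, fun Q' hsep => ?_⟩
  obtain ⟨G1, G2, G3, G4, G5⟩ := stub_periodicMeanFamily δ Q' hδ hsep
  have G6 : ∀ r ρ : ℝ, 0 ≤ r → ∀ g : EuclideanSpace ℝ (Fin 3) → Finset (EuclideanSpace ℝ (Fin 3)) → Finset (EuclideanSpace ℝ (Fin 3)) → ℝ, (∃ M : ℝ, ∀ v p q, |g v p q| ≤ M) →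
      (fun (ρ : ℝ) (f : Finset (EuclideanSpace ℝ (Fin 3)) → ℝ) => (Q'.motif.card : ℝ)⁻¹ * ∑ x ∈ Q'.motif, f (((Literature.MathematicalPhysics.StatisticalMechanics.PeriodicConfiguration.finite_inter_points Q' (Metric.isBounded_closedBall (x := x) (r := ρ))).toFinset.erase x).image (fun y => y - x))) ρ
        (fun S => ∑ v ∈ Literature.Probability.PointProcesses.lens r ρ S, (g v (Literature.Probability.PointProcesses.ballPattern r S) (Literature.Probability.PointProcesses.ballPattern r (Literature.Probability.PointProcesses.reroot S v)) - g (-v) (Literature.Probability.PointProcesses.ballPattern r (Literature.Probability.PointProcesses.reroot S v)) (Literature.Probability.PointProcesses.ballPattern r S))) = 0 := by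
    intro r ρ hr g _
    have h := stub_periodicTransport Q' r ρ hr g
    beta_reduce at h ⊢
    rw [h, mul_zero]
  have key := hprim (fun (ρ : ℝ) (f : Finset (EuclideanSpace ℝ (Fin 3)) → ℝ) => (Q'.motif.card : ℝ)⁻¹ * ∑ x ∈ Q'.motif, f (((Literature.MathematicalPhysics.StatisticalMechanics.PeriodicConfiguration.finite_inter_points Q' (Metric.isBounded_closedBall (x := x) (r := ρ))).toFinset.erase x).image (fun y => y - x)))
    G1 G2 G3 G4 G5 G6
  beta_reduce at key
  -- the defect term is a cylinder functional of radius `R + ε`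
  have hbad : ∀ ρ : ℝ, R + ε ≤ ρ →
      (Q'.motif.card : ℝ)⁻¹ * ∑ x ∈ Q'.motif, (if (∃ A : EuclideanSpace ℝ (Fin 3) →ₗᵢ[ℝ] EuclideanSpace ℝ (Fin 3), (∀ p ∈ P.points, ‖p‖ ≤ R → ∃ v ∈ insert (0 : EuclideanSpace ℝ (Fin 3)) (((Literature.MathematicalPhysics.StatisticalMechanics.PeriodicConfiguration.finite_inter_points Q' (Metric.isBounded_closedBall (x := x) (r := ρ))).toFinset.erase x).image (fun y => y - x)), dist v (A p) ≤ ε) ∧ (∀ v ∈ insert (0 : EuclideanSpace ℝ (Fin 3)) (((Literature.MathematicalPhysics.StatisticalMechanics.PeriodicConfiguration.finite_inter_points Q' (Metric.isBounded_closedBall (x := x) (r := ρ))).toFinset.erase x).image (fun y => y - x)), ‖v‖ ≤ R → ∃ p ∈ P.points, dist v (A p) ≤ ε)) then (0 : ℝ) else 1) = (Q'.motif.card : ℝ)⁻¹ * ∑ x ∈ Q'.motif, (if (∃ A : EuclideanSpace ℝ (Fin 3) →ₗᵢ[ℝ] EuclideanSpace ℝ (Fin 3), (∀ p ∈ P.points,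 ‖p‖ ≤ R → ∃ v ∈ insert (0 : EuclideanSpace ℝ (Fin 3)) (((Literature.MathematicalPhysics.StatisticalMechanics.PeriodicConfiguration.finite_inter_points Q' (Metric.isBounded_closedBall (x := x) (r := (R + ε)))).toFinset.erase x).image (fun y => y - x)), dist v (A p) ≤ ε) ∧ (∀ v ∈ insert (0 : EuclideanSpace ℝ (Fin 3)) (((Literature.MathematicalPhysics.StatisticalMechanics.PeriodicConfiguration.finite_inter_points Q' (Metric.isBounded_closedBall (x := x) (r := (R + ε)))).toFinset.erase x).image (fun y => y - x)), ‖v‖ ≤ R → ∃ p ∈ P.points, dist v (A p) ≤ ε)) then (0 : ℝ) else 1) := by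
    intro ρ hρ
    have h5 := G5 (R + ε) ρ hρ (fun S => (if (∃ A : EuclideanSpace ℝ (Fin 3) →ₗᵢ[ℝ] EuclideanSpace ℝ (Fin 3), (∀ p ∈ P.points, ‖p‖ ≤ R → ∃ v ∈ insert (0 : EuclideanSpace ℝ (Fin 3)) S, dist v (A p) ≤ ε) ∧ (∀ v ∈ insert (0 : EuclideanSpace ℝ (Fin 3)) S, ‖v‖ ≤ R → ∃ p ∈ P.points, dist v (A p) ≤ ε)) then (0 : ℝ) else 1))
    beta_reduce at h5
    rw [← h5]
    congr 1
    refine Finset.sum_congr rfl fun x _ => ?_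
    rw [levelLift_good_ballPattern_iff P hε.le le_rfl]
  -- let `ρ → ∞` in the truncated energies
  have hlim := stub_periodicTruncatedEnergy Q'
  refine ge_of_tendsto hlim (Filter.eventually_atTop.2 ⟨max (R + ε) 1, fun ρ hρ => ?_⟩)
  have h1 : R + ε ≤ ρ := (le_max_left _ _).trans hρ
  have h2 : 1 ≤ ρ := (le_max_right _ _).trans hρ
  have hk := key ρ h1 h2
  rw [hbad ρ h1] at hk
  exact hk


end Summit.AtomisticToContinuum.Crystallization.Theorems.PatternPricedCertificates

end
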